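import Literature.MathematicalPhysics.QuantumFieldTheory.Balaban1983to89.B5Symbol163

/-!
# `Balaban1983to89.B5Eq163PrintedBarsFail` — [Balaban1984PropagatorsI] (1.63) p. 28 (row B5.Eq1.63): the FIRST printed
expression, with its conjugation bars AS PRINTED, is NOT equal to the second one in general — a kernel witness for the
«print slip» of cell census GAPS G-B5-14 (ii)

statement-level skeleton of published theorems with citation tags; proofs where landed; nothing here is a claim about the Yang–Mills mass gap

CITATION HEADER.  T. Bałaban, *Propagators and renormalization transformations for lattice gauge theories. I*, Commun.
Math. Phys. **95** (1984) 17–40 [Balaban1984PropagatorsI] (cell paper B5), p. 28 [PDF 12], display (1.63) (the two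
momentum representations of `H_kB`; printed text reproduced verbatim in the header of `…B5Symbol163`).  Unit
`lit-balaban-r02` gen 3 (B5 reader/typer and fold owner; HOME `run/shared/lean/pub/lit-balaban/`).  SKELETON row
**B5.Eq1.63** carries «first form refuted-as-printed (print slip, G-B5-14)»: `…B5Symbol163` types the first expression
with the bars AS PRINTED (`firstPrinted163`: `\overline{∂¹_μ(p′)}` inside the bracket, no bar on `∂¹_λ(p′)` in `Σ_λ`)
and with the bars of (1.60)/(1.62) (`first163`), proves `first163 = second163` (`first163_eq_second163_vOf`, with
`v_μ = ∂¹_μ/∂_μ` of (1.61)) and `firstPrinted163 = first163` WHEN every `∂¹_ν(p′)` is real (`firstPrinted163_eq_first163`).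
This file supplies the missing half: a point where `∂¹_μ(p′)` is NOT real and the printed first expression differs from
the second — so the printed bars cannot both be right, as the census says.

THE WITNESS.  One alias index (`ι = Fin 1`), one direction (`κ = Fin 1`); `u = 1`, `∂_μ(p′+l) = 1`, `∂¹_μ(p′) = i`
(so `v_μ = ∂¹_μ/∂_μ = i` by (1.61)), `Δ(p′+l) = 1`, `Δ₀(p′) = 1`, `φ_μ = |u|²|v|²/Δ = 1` ((1.62)), `B̃ = 1`.  Then the
second expression is `\overline{uv}·B̃ = −i` (its alias sum over `l′ ≠ l` is empty), the corrected first expression is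
`−i` too, but the PRINTED first expression is `−i + (1 − \bar{i}·\bar{i})·i = −i + 2i = i`.

WHAT THIS FILE PROVES.  `second163_witness` (= −i), `first163_witness` (= −i), `firstPrinted163_witness` (= i),
**`firstPrinted163_ne_second163`**, and the negation of the printed identity as a universally quantified statement
**`not_forall_firstPrinted163_eq_second163`**.  HONEST SCOPE: an algebraic witness over the abstract symbol entries of
`…B5Symbol163` (any values are admissible there; the entries are not tied to a lattice momentum here — at lattice momenta
with `e^{ip′_ν} = ±1` the two readings agree, `firstPrinted163_eq_first163`); value = kernel evidence for the ERRATA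
register entry of row B5.Eq1.63, nothing more.  No `sorry`, no new `def … : Prop`; axioms standard.
-/

namespace Literature.MathematicalPhysics.QuantumFieldTheory.Balaban1983to89.B5Eq163PrintedBarsFail

open Complex ComplexConjugate Finset
open Literature.MathematicalPhysics.QuantumFieldTheory.Balaban1983to89.B5Symbol163

noncomputable section

/-- witness entry `u(p′+l) = 1` (one alias index). [folklore] -/
def uW : Fin 1 → ℂ := fun _ => 1
/-- witness entry `v_μ(p′+l) = i` (= `∂¹_μ/∂_μ`, (1.61)). [folklore] -/
def vW : Fin 1 → ℂ := fun _ => I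
/-- witness entry `∂_μ(p′+l) = 1`. [folklore] -/
def dW : Fin 1 → ℂ := fun _ => 1
/-- witness entry `Δ(p′+l) = 1`. [folklore] -/
def DW : Fin 1 → ℂ := fun _ => 1
/-- witness entry `∂¹_μ(p′) = i` (one direction; NOT real). [folklore] -/
def dOneW : Fin 1 → ℂ := fun _ => I
/-- witness entry `φ_μ(p′) = 1` (= `|u|²|v|²/Δ`, (1.62)). [folklore] -/
def phiW : Fin 1 → ℂ := fun _ => 1
/-- witness entry `B̃_μ(p′) = 1`. [folklore] -/
def BtW : Fin 1 → ℂ := fun _ => 1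

/-- at the witness, `v = ∂¹/∂` as (1.61) requires. [cite: Balaban1984PropagatorsI, (1.61) p.28] -/
theorem vW_eq_vOf : vW = vOf (dOneW 0) dW := by
  funext l; simp [vW, vOf, dOneW, dW]

/-- at the witness, `φ_μ = Σ_l |u|²|v_μ|²/Δ` as (1.62) requires. [cite: Balaban1984PropagatorsI, (1.62) p.28] -/
theorem phiW_eq_phiSym : phiW 0 = phiSym uW vW DW := by
  simp [phiW, phiSym, uW, vW, DW, Complex.normSq_I]

/-- `S = 1` at the witness. [folklore] -/
private theorem sSym_W : sSym uW DW 1 = 1 := by simp [sSym, uW, DW]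

/-- `φ = 1` at the witness. [folklore] -/
private theorem phiSym_W : phiSym uW vW DW = 1 := by simp [phiSym, uW, vW, DW, Complex.normSq_I]

/-- `N = 1` at the witness. [folklore] -/
private theorem nSym_W : nSym dOneW phiW 1 = 1 := by simp [nSym, dOneW, phiW, Complex.normSq_I]

/-- the common first term is `\overline{uv}·B̃ = −i` at the witness. [folklore] -/
private theorem head_W : head163 uW vW DW 1 BtW 0 0 = -I := by
  simp [head163, uW, vW, DW, BtW, phiSym_W, Complex.conj_I]

/-- **the SECOND expression of (1.63) at the witness is `−i`** (its sum over `l′ ≠ l` is empty).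
[cite: Balaban1984PropagatorsI, (1.63) p.28] -/
theorem second163_witness : second163 uW vW dW DW 1 dOneW phiW BtW 0 0 = -I := by
  have he : (univ : Finset (Fin 1)).erase 0 = ∅ := by decide
  rw [second163, head_W, he, Finset.sum_empty]
  simp

/-- the corrected first expression at the witness is `−i` as well (an instance of `first163_eq_second163_vOf`).
[cite: Balaban1984PropagatorsI, (1.63) p.28] -/
theorem first163_witness : first163 uW vW dW DW 1 dOneW phiW BtW 0 0 = -I := by
  rw [← second163_witness, vW_eq_vOf]
  exact first163_eq_second163_vOf uW dW DW 1 dOneW phiW BtW 0 one_ne_zero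
    (by rw [sSym_W]; exact one_ne_zero) (by rw [← vW_eq_vOf, phiSym_W]; exact one_ne_zero) 0

/-- **the FIRST expression of (1.63) with the bars AS PRINTED is `i` at the witness.**
[cite: Balaban1984PropagatorsI, (1.63) p.28] -/
theorem firstPrinted163_witness : firstPrinted163 uW vW dW DW 1 dOneW phiW BtW 0 0 = I := by
  rw [firstPrinted163, head_W, sSym_W, phiSym_W, nSym_W]
  simp [uW, vW, dW, DW, dOneW, phiW, BtW, Complex.conj_I]
  ring_nf

/-- **G-B5-14 (ii) as a kernel theorem: the printed first expression of (1.63) is NOT the second one** (here `i ≠ −i`).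
[cite: Balaban1984PropagatorsI, (1.63) p.28] -/
theorem firstPrinted163_ne_second163 :
    firstPrinted163 uW vW dW DW 1 dOneW phiW BtW 0 0 ≠ second163 uW vW dW DW 1 dOneW phiW BtW 0 0 := by
  rw [firstPrinted163_witness, second163_witness]
  intro h
  have := congrArg Complex.im h
  norm_num at this

/-- Hence the identity «first printed expression = second expression» of (1.63), read with the bars as printed, does
not hold for all symbol data satisfying (1.61)–(1.62) — the print slip recorded in the ERRATA register for row
B5.Eq1.63 (with the bars of (1.60)/(1.62) it does hold: `B5Symbol163.first163_eq_second163_vOf`).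
[cite: Balaban1984PropagatorsI, (1.63) p.28] -/
theorem not_forall_firstPrinted163_eq_second163 :
    ¬ ∀ (u dμ D : Fin 1 → ℂ) (Δ₀ : ℂ) (dOne phiDir Bt : Fin 1 → ℂ) (μ : Fin 1) (l : Fin 1),
        firstPrinted163 u (vOf (dOne μ) dμ) dμ D Δ₀ dOne phiDir Bt μ l
          = second163 u (vOf (dOne μ) dμ) dμ D Δ₀ dOne phiDir Bt μ l := by
  intro h
  have h1 := h uW dW DW 1 dOneW phiW BtW 0 0
  rw [← vW_eq_vOf] at h1
  exact firstPrinted163_ne_second163 h1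

end

end Literature.MathematicalPhysics.QuantumFieldTheory.Balaban1983to89.B5Eq163PrintedBarsFail
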